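import Summits.CriticalPhenomena.PercolationContinuityZ3.Theorems.PercNearOneGluingNoHeavyPcintNawFreeMem
import HarnessLib

/-!
# PCINT lane, reduction B2d on the dangerous-set automaton — CLAIMED payments bound the step factor from above

Cell `prim-pcint` (PAPER-2 track (iii)), seat `prim-pcint-1` (gen 8); support file (`--supports stmt-CriticalPhenomena-4575`).
Does NOT build on p205010.  Memo: run/shared/lean/prim/pcint/REDUCTIONS.md §B2d and prim-pcint-1/gen8/README.md ("witness-carrying
certificates").

The B2d step factor `fwt τ kt qv S a = fU · ((1 + fC)/2)^{[fhasC]}` is a product of numbers in `[0,1]`.  A certificate need not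
re-derive it: it may CLAIM a sub-collection of the payments — a set `U` of inspected sites that are unconditional (`funcond`), each with
a claimed number of payments `np w ≤ fnpay w` and a claimed count `cn w ≥ fcnt w`, and optionally the corner site `w₀` (`fcorner`) with
the same data and `np₀ ≥ 1` — and the product of the CLAIMED factors `qv (cn w) ^ np w` (the corner one averaged with `1`) is an
upper bound for `fwt` (`fwt_le_prod_claims`, `fwt_le_prod_claims_corner`), for every nondecreasing weight family `qv` with values in
`[0,1]`.  A kernel checker therefore only has to verify the claims it is given (each with `O(1)` witnesses), charging nothing for
unclaimed sites; this file is the semantic half of that design.  No definitions.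
-/

noncomputable section

namespace Summit.CriticalPhenomena.PercolationContinuityZ3.Theorems.Pcint

open Finset Literature.Probability.Percolation Literature.Probability.LatticeModels

variable {d : ℕ} {τ kt : ℕ} {qv : ℕ → ℝ}

section Claims

/-- A product of factors in `[0,1]` over a finset is at most the product over any subset. [folklore] -/
theorem prod_le_prod_of_subset_of_le_one_real {s T : Finset (Site d)} {f : Site d → ℝ} (hT : T ⊆ s) (h0 : ∀ w ∈ s, 0 ≤ f w)
    (h1 : ∀ w ∈ s, f w ≤ 1) : ∏ w ∈ s, f w ≤ ∏ w ∈ T, f w := by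
  rw [← prod_sdiff hT]
  have hA : ∏ w ∈ s \ T, f w ≤ 1 :=
    prod_le_one (fun w hw => h0 w (sdiff_subset hw)) fun w hw => h1 w (sdiff_subset hw)
  have hB : 0 ≤ ∏ w ∈ T, f w := prod_nonneg fun w hw => h0 w (hT hw)
  calc (∏ w ∈ s \ T, f w) * ∏ w ∈ T, f w ≤ 1 * ∏ w ∈ T, f w := mul_le_mul_of_nonneg_right hA hB
    _ = ∏ w ∈ T, f w := one_mul _

/-- A Boolean-guarded power of a `[0,1]`-valued family is nonnegative. [folklore] -/
theorem ite_pow_nonneg (hq0 : ∀ k, 0 ≤ qv k) (b : Bool) (k n : ℕ) : 0 ≤ (if b then qv k ^ n else (1 : ℝ)) := by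
  split_ifs <;> [exact pow_nonneg (hq0 _) _; exact zero_le_one]

/-- A Boolean-guarded power of a `[0,1]`-valued family is at most one. [folklore] -/
theorem ite_pow_le_one (hq0 : ∀ k, 0 ≤ qv k) (hq1 : ∀ k, qv k ≤ 1) (b : Bool) (k n : ℕ) :
    (if b then qv k ^ n else (1 : ℝ)) ≤ 1 := by
  split_ifs <;> [exact pow_le_one₀ (hq0 _) (hq1 _); exact le_rfl]

/-- A claimed factor dominates the true one: `qv (fcnt)^fnpay ≤ qv c ^ n` when `n ≤ fnpay` and `fcnt ≤ c` (`qv` nondecreasing with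
values in `[0,1]`). [folklore] -/
theorem pow_fcnt_le_claim (hq0 : ∀ k, 0 ≤ qv k) (hq1 : ∀ k, qv k ≤ 1) (hmono : ∀ k k', k ≤ k' → qv k ≤ qv k')
    {S : MState d} {a : Fin d × Bool} {w : Site d} {n c : ℕ} (hn : n ≤ fnpay τ kt S a w) (hc : fcnt τ S a w ≤ c) :
    qv (fcnt τ S a w) ^ fnpay τ kt S a w ≤ qv c ^ n :=
  (pow_le_pow_of_le_one (hq0 _) (hq1 _) hn).trans (pow_le_pow_left₀ (hq0 _) (hmono _ _ hc) n)

/-- **`fU` is at most the claimed unconditional product** (claimed sites are unconditional inspected sites, `np ≤ fnpay`, `cn ≥ fcnt`).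
[folklore] -/
theorem fU_le_prod_claims (hq0 : ∀ k, 0 ≤ qv k) (hq1 : ∀ k, qv k ≤ 1) (hmono : ∀ k k', k ≤ k' → qv k ≤ qv k')
    {S : MState d} {a : Fin d × Bool} {U : Finset (Site d)} {np cn : Site d → ℕ} (hUsub : U ⊆ fsites kt S a)
    (hUunc : ∀ w ∈ U, funcond S a w = true) (hUnp : ∀ w ∈ U, np w ≤ fnpay τ kt S a w)
    (hUcn : ∀ w ∈ U, fcnt τ S a w ≤ cn w) : fU τ kt qv S a ≤ ∏ w ∈ U, qv (cn w) ^ np w := by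
  unfold fU
  refine (prod_le_prod_of_subset_of_le_one_real hUsub (fun w _ => ite_pow_nonneg hq0 _ _ _)
    fun w _ => ite_pow_le_one hq0 hq1 _ _ _).trans ?_
  refine prod_le_prod (fun w _ => ite_pow_nonneg hq0 _ _ _) fun w hw => ?_
  rw [if_pos (hUunc w hw)]
  exact pow_fcnt_le_claim hq0 hq1 hmono (hUnp w hw) (hUcn w hw)

/-- The corner part of the step factor is at most one. [folklore] -/
theorem fwt_cpart_le_one (hq0 : ∀ k, 0 ≤ qv k) (hq1 : ∀ k, qv k ≤ 1) (S : MState d) (a : Fin d × Bool) :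
    (if fhasC τ kt S a then (1 + fC τ kt qv S a) / 2 else (1 : ℝ)) ≤ 1 := by
  split_ifs
  · have := fC_le_one (τ := τ) (kt := kt) hq0 hq1 S a; linarith
  · exact le_rfl

/-- The corner part of the step factor is nonnegative. [folklore] -/
theorem fwt_cpart_nonneg (hq0 : ∀ k, 0 ≤ qv k) (S : MState d) (a : Fin d × Bool) :
    0 ≤ (if fhasC τ kt S a then (1 + fC τ kt qv S a) / 2 else (1 : ℝ)) := by
  split_ifs
  · have := fC_nonneg (τ := τ) (kt := kt) hq0 S a; linarith
  · exact zero_le_one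

/-- **Claims without a corner**: `fwt ≤ ∏_{w ∈ U} qv (cn w) ^ np w`. [folklore] -/
theorem fwt_le_prod_claims (hq0 : ∀ k, 0 ≤ qv k) (hq1 : ∀ k, qv k ≤ 1) (hmono : ∀ k k', k ≤ k' → qv k ≤ qv k')
    {S : MState d} {a : Fin d × Bool} {U : Finset (Site d)} {np cn : Site d → ℕ} (hUsub : U ⊆ fsites kt S a)
    (hUunc : ∀ w ∈ U, funcond S a w = true) (hUnp : ∀ w ∈ U, np w ≤ fnpay τ kt S a w)
    (hUcn : ∀ w ∈ U, fcnt τ S a w ≤ cn w) : fwt τ kt qv S a ≤ ∏ w ∈ U, qv (cn w) ^ np w := by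
  unfold fwt
  calc fU τ kt qv S a * (if fhasC τ kt S a then (1 + fC τ kt qv S a) / 2 else 1)
      ≤ (∏ w ∈ U, qv (cn w) ^ np w) * 1 :=
        mul_le_mul (fU_le_prod_claims hq0 hq1 hmono hUsub hUunc hUnp hUcn) (fwt_cpart_le_one hq0 hq1 S a)
          (fwt_cpart_nonneg hq0 S a) (prod_nonneg fun _ _ => pow_nonneg (hq0 _) _)
    _ = ∏ w ∈ U, qv (cn w) ^ np w := mul_one _

/-- **Claims with the corner**: if in addition the corner site `w₀ ∉ U` (`fcorner`) is claimed with `1 ≤ np₀ ≤ fnpay w₀` and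
`cn₀ ≥ fcnt w₀`, then `fwt ≤ (∏_{w ∈ U} qv (cn w) ^ np w) · (1 + qv cn₀ ^ np₀) / 2` — whether or not the corner site is in truth
unconditional (a factor `c ≤ 1` booked unconditionally is below its conditional booking `(1 + c)/2`). [folklore] -/
theorem fwt_le_prod_claims_corner (hq0 : ∀ k, 0 ≤ qv k) (hq1 : ∀ k, qv k ≤ 1) (hmono : ∀ k k', k ≤ k' → qv k ≤ qv k')
    {S : MState d} {a : Fin d × Bool} {U : Finset (Site d)} {np cn : Site d → ℕ} (hUsub : U ⊆ fsites kt S a)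
    (hUunc : ∀ w ∈ U, funcond S a w = true) (hUnp : ∀ w ∈ U, np w ≤ fnpay τ kt S a w)
    (hUcn : ∀ w ∈ U, fcnt τ S a w ≤ cn w) {w₀ : Site d} {np₀ cn₀ : ℕ} (hw₀ : w₀ ∈ fsites kt S a) (hw₀U : w₀ ∉ U)
    (hcor : fcorner kt S a w₀ = true) (hnp₀ : np₀ ≤ fnpay τ kt S a w₀) (hnp₀' : 1 ≤ np₀) (hcn₀ : fcnt τ S a w₀ ≤ cn₀) :
    fwt τ kt qv S a ≤ (∏ w ∈ U, qv (cn w) ^ np w) * ((1 + qv cn₀ ^ np₀) / 2) := by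
  set c : ℝ := qv cn₀ ^ np₀ with hc
  set c' : ℝ := qv (fcnt τ S a w₀) ^ fnpay τ kt S a w₀ with hc'
  set PU : ℝ := ∏ w ∈ U, qv (cn w) ^ np w with hPU
  have hc'c : c' ≤ c := pow_fcnt_le_claim hq0 hq1 hmono hnp₀ hcn₀
  have hc1 : c ≤ 1 := pow_le_one₀ (hq0 _) (hq1 _)
  have hc'0 : 0 ≤ c' := pow_nonneg (hq0 _) _
  have hcm : c ≤ (1 + c) / 2 := by linarith
  have hU := fU_le_prod_claims hq0 hq1 hmono hUsub hUunc hUnp hUcn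
  have hUn : 0 ≤ PU := prod_nonneg fun _ _ => pow_nonneg (hq0 _) _
  have hgp := fwt_cpart_nonneg (τ := τ) (kt := kt) hq0 S a
  have hg1 := fwt_cpart_le_one (τ := τ) (kt := kt) hq0 hq1 S a
  unfold fwt
  by_cases hunc : funcond S a w₀ = true
  · -- the corner site is unconditional in truth: its factor `c'` sits in `fU`
    have hsub : insert w₀ U ⊆ fsites kt S a := insert_subset hw₀ hUsub
    have hU' : fU τ kt qv S a ≤ c' * PU := by
      unfold fU
      refine (prod_le_prod_of_subset_of_le_one_real hsub (fun w _ => ite_pow_nonneg hq0 _ _ _)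
        fun w _ => ite_pow_le_one hq0 hq1 _ _ _).trans ?_
      rw [prod_insert hw₀U, if_pos hunc]
      refine mul_le_mul_of_nonneg_left ?_ hc'0
      exact prod_le_prod (fun w _ => ite_pow_nonneg hq0 _ _ _) fun w hw => by
        rw [if_pos (hUunc w hw)]; exact pow_fcnt_le_claim hq0 hq1 hmono (hUnp w hw) (hUcn w hw)
    calc fU τ kt qv S a * (if fhasC τ kt S a then (1 + fC τ kt qv S a) / 2 else 1)
        ≤ c' * PU * 1 := mul_le_mul hU' hg1 hgp (mul_nonneg hc'0 hUn)
      _ ≤ (1 + c) / 2 * PU := by rw [mul_one]; exact mul_le_mul_of_nonneg_right (hc'c.trans hcm) hUn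
      _ = PU * ((1 + c) / 2) := mul_comm _ _
  · -- the corner site is conditional: the step has a conditional payment and `fC ≤ c'`
    rw [Bool.not_eq_true] at hunc
    have hcond : fcond kt S a w₀ = true := (fcond_iff kt).2 ⟨hunc, hcor⟩
    have hpay : fnpay τ kt S a w₀ ≠ 0 := by omega
    have hhas : fhasC τ kt S a = true := (fhasC_iff τ kt).2 ⟨w₀, hw₀, hcond, hpay⟩
    have hCle : fC τ kt qv S a ≤ c' := by
      unfold fC
      refine (prod_le_prod_of_subset_of_le_one_real (singleton_subset_iff.2 hw₀) (fun w _ => ite_pow_nonneg hq0 _ _ _)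
        fun w _ => ite_pow_le_one hq0 hq1 _ _ _).trans ?_
      rw [prod_singleton, if_pos hcond]
    rw [if_pos hhas]
    have hCn := fC_nonneg (τ := τ) (kt := kt) hq0 S a
    calc fU τ kt qv S a * ((1 + fC τ kt qv S a) / 2) ≤ PU * ((1 + c) / 2) :=
          mul_le_mul hU (by linarith) (by linarith) hUn
      _ = PU * ((1 + c) / 2) := rfl

end Claims

end Summit.CriticalPhenomena.PercolationContinuityZ3.Theorems.Pcint
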